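import Summits.HodgeConjecture.HodgeConjecture.Theorems.K2E1bCubicCasimirExtremeVector
import Literature.RepresentationTheory.BorelWallach2000.U11WeightDecomposition
import Literature.RepresentationTheory.BorelWallach2000.UpqMaximalCompactExp
import HarnessLib

/-!
# K2 ∕ E1b — αᵤ road FILE 1 «TORUS WEIGHT SPACES of a `(𝔤, K)`-module of `U(2,1)`» (O4 of the 8b-α census)

Cell hodgecm-mathlib, Track B «K2-LIT», engine E1b, unit U8 «archimedean packet signs»; crux item h413 = stmt-HodgeConjecture-24833
(supports-only helper; closes nothing by itself).  DEAL (c) of K2E1b-plan (g4) 2026-09-04T03:49:16Z («file 1 `K2E1bU21WeightSpaces` → K2-defs1»,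
GO 03:56:06Z on the HEAD v1; K2E1b-r01 (g4) statement pre-read PASS 03:58:09Z) on the road to the socket 8b-αᵤ `ModelOfRecordCohUnitaryStmt`
(★ `Theorems/K2E1bUnitaryDualOfPartsCohUnitary.lean`; census `K2/K2-defs1/g3/CENSUS-8b-alpha-ModelOfRecord.K2-defs1-g3.md` §3 file 1).  Author
K2-defs1 (g3).  DEFINITIONS WITH BODIES (`tUnit`, `wtSpace`) + theorems; no `sorry`, no axiom, no instance (one
`attribute [local instance] LieRing.ofAssociativeRing`, the Mathlib idiom of every ★ `Upq*` ∕ `GK*` file), no notation.  SEQUEL (§3, split for the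
400-line lint): `Theorems/K2E1bU21HighestWeightSpaces.lean` (root operators ★ `u21e∕u21f∕u21h∕u21E∕u21F` on weight spaces, `hwSpace`, the labels `(n,m,e)`).

## What is proved (Knapp–Vogan Prop. 1.18 (a) for the diagonal TORUS of `U(2,1)`, no Haar measure — the road of ★ `GKWeights`)

* §1 the torus units `t_j = i·E_jj ∈ 𝔨` (`tUnit j : G21.compactLie`, `j : Fin 2 ⊕ Fin 1`): matrix `diag(δ_j i)` (`coe_tUnit`, `coe_inclusion_tUnit`),
  `exp(s t_j) = diag(e^{s δ_j i})` (`coe_expK_smul_tUnit`), PERIODICITY `exp(2π t_j) = 1` (`expK_two_pi_tUnit`), `ρ𝔤(t_j) = i·ρ_ℂ(E_jj)` through the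
  complexified action ★ `upqLieC` (`apply_tUnit_eq`, and the two eigenvalue dictionaries), the `ρ_ℂ(E_jj)` commute (`commute_upqLieC_single_diag`,
  `commute_apply_tUnit`).
* §2 **`wtSpace ρ𝔤 w := ⨅ j, eigenspace (ρ_ℂ(E_jj)) (w j)`** for `w : Fin 2 ⊕ Fin 1 → ℤ` (torus weight `diag(u) ↦ Π u_j^{w j}`); `mem_wtSpace_iff`;
  **`upqLieC_single_apply_mem_wtSpace`**: `ρ_ℂ(E_ab) V[w] ⊆ V[w + δ_a − δ_b]` (root operators shift weights, via ★ `lieHom_single_apply_comm`); and for a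
  `(𝔤, K)`-module (`hV : IsGKModule G21 ρK ρ𝔤`): `exists_int_of_eigenvector` (eigenvalues of `ρ_ℂ(E_jj)` are INTEGERS — ★ `exp_mul_eq_one_of_eigenvector` +
  periodicity), **`iSup_wtSpace_eq_top`** (`V = ⨆_w V[w]`: the finite-dimensional `K`-span of a vector is the sum of the joint generalised eigenspaces of
  the three commuting `ρ𝔤(t_j)` — Mathlib `iSup_iInf_maxGenEigenspace_eq_top_of_iSup_maxGenEigenspace_eq_top_of_commute` — and generalised eigenvectors
  are eigenvectors by ★ `GKWeights.maxGenEigenspace_eq_eigenspace`, periodicity kills nilpotents), **`iSupIndep_wtSpace`** (pure linear algebra, no `hV`),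
  **`isInternal_wtSpace : DirectSum.IsInternal (wtSpace ρ𝔤)`** — `V = ⨁_{w ∈ ℤ³} V[w]`.

HONEST SCOPE: torus weight spaces of an infinite-dimensional admissible module are in general INFINITE-dimensional (a torus weight recurs in the `K`-types
`(n, m)` for unboundedly many `n`); the finite object is the `𝔨`-highest line `hwSpace` of the sequel, finite-dimensional under ADMISSIBILITY and a line
under multiplicity one (files 2a∕2b, K2E4-p11 (g2)).  Nothing here uses irreducibility, admissibility or unitarity.

Sources: [KnappVogan1995] A. W. Knapp, D. A. Vogan, *Cohomological Induction and Unitary Representations* (1995), §I.2 (1.17)–(1.19), Prop. 1.18;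
[BorelWallach2000] 0 §2.5, II §4.1, VI 4.7; [Knapp2002] VI §2 (`𝔲(p,q)`, the complexified action); [Kovacevic2021] §3 Def 1 (the labels `(n, m)`).

HONEST LABEL: HC_CM is proved only modulo the 7 printed citations (2 remaining named inputs: hLiu418 = stmt-HodgeConjecture-24832,
h413 = stmt-HodgeConjecture-24833) until rung 0 closes; this file is currency for the αᵤ road and closes nothing.
-/

set_option autoImplicit false
set_option linter.dupNamespace false

noncomputable section

open scoped Matrix ComplexConjugate

namespace Summit.HodgeConjecture.HodgeConjecture.Cruxes.H413.K2E1bU21Weights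

open Literature.NumberTheory.Automorphic
open Literature.RepresentationTheory
open Literature.RepresentationTheory.BorelWallach2000
open Literature.RepresentationTheory.KonnoKonno2007 Literature.RepresentationTheory.KonnoKonno2007.RealDualPair
open Literature.RepresentationTheory.KonnoKonno2007.RealDualPair.UForm
open Summit.HodgeConjecture.HodgeConjecture.Cruxes.H413.F0P3bLocalAPacketsDefs
open Summit.HodgeConjecture.HodgeConjecture.Cruxes.H413.K2E1bGKCohomologyU21 (lieHom_single_apply_comm)

-- Mathlib idiom (as in `GKModules`, the `Upq*` files): commutator bracket on `Module.End` ∕ matrices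
attribute [local instance 100] LieRing.ofAssociativeRing

/-! ## §1 The three diagonal torus units `t_j = i·E_jj ∈ 𝔨` -/

/-- `diag(δ_j · i) = i · E_jj` as matrices. [folklore] -/
theorem diagonal_single_I (j : Fin 2 ⊕ Fin 1) :
    Matrix.diagonal (Pi.single j Complex.I : Fin 2 ⊕ Fin 1 → ℂ) = Complex.I • Matrix.single j j (1 : ℂ) := by
  ext a b
  rw [Matrix.diagonal_apply, Matrix.smul_apply, Matrix.single_apply, Pi.single_apply, smul_eq_mul, mul_ite, mul_one, mul_zero]
  by_cases h1 : a = b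
  · subst h1
    by_cases h2 : a = j
    · subst h2; simp
    · rw [if_pos rfl, if_neg h2, if_neg (fun h => h2 h.1.symm)]
  · rw [if_neg h1, if_neg (fun h => h1 (h.1.symm.trans h.2))]

/-- `(diag(δ_j · i))ᴴ = −diag(δ_j · i)` (skew-Hermitian). [folklore] -/
theorem diagonal_single_I_conjTranspose (j : Fin 2 ⊕ Fin 1) :
    (Matrix.diagonal (Pi.single j Complex.I : Fin 2 ⊕ Fin 1 → ℂ))ᴴ = Matrix.diagonal fun a => -(Pi.single j Complex.I : Fin 2 ⊕ Fin 1 → ℂ) a := by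
  rw [Matrix.diagonal_conjTranspose]
  refine congrArg Matrix.diagonal (funext fun a => ?_)
  rw [Pi.star_apply]
  by_cases h : a = j
  · subst h; simp [Complex.conj_I]
  · simp [h]

/-- The diagonal matrix unit `i·E_jj` is skew-Hermitian and lies in `𝔲(2,1)`, hence in `𝔨 = 𝔤 ∩ 𝔲(3)`. [cite: BorelWallach2000, VI 4.7] -/
theorem diagonal_single_I_mem_compactLie (j : Fin 2 ⊕ Fin 1) :
    Matrix.diagonal (Pi.single j Complex.I : Fin 2 ⊕ Fin 1 → ℂ) ∈ G21.compactLie := by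
  rw [RealMatrixGroup.mem_compactLie_iff]
  refine ⟨?_, ?_⟩
  · rw [mem_uFormGroup_lie_iff, diagonal_single_I_conjTranspose, signForm_eq_diagonal]
    ext a b
    simp only [Matrix.add_apply, Matrix.mul_diagonal, Matrix.diagonal_apply, Matrix.zero_apply]
    by_cases hab : a = b
    · subst hab; rw [if_pos rfl, if_pos rfl]; ring
    · rw [if_neg hab, if_neg hab]; ring
  · rw [Matrix.star_eq_conjTranspose, diagonal_single_I_conjTranspose, ← Matrix.diagonal_neg]

/-- **The torus unit `t_j := i·E_jj ∈ 𝔨`** (`j ∈ Fin 2 ⊕ Fin 1`; matrix `diag(δ_j · i)`): the three generate the diagonal maximal torus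
`T = U(1)³` of `K = U(2) × U(1)`. — a route-posited definition of the engine line (hence untagged). -/
def tUnit (j : Fin 2 ⊕ Fin 1) : G21.compactLie :=
  ⟨Matrix.diagonal (Pi.single j Complex.I : Fin 2 ⊕ Fin 1 → ℂ), diagonal_single_I_mem_compactLie j⟩

/-- The matrix of `t_j`. [cite: BorelWallach2000, VI 4.7] -/
@[simp] theorem coe_tUnit (j : Fin 2 ⊕ Fin 1) : ((tUnit j : G21.compactLie) : Matrix (Fin 2 ⊕ Fin 1) (Fin 2 ⊕ Fin 1) ℂ) =
    Matrix.diagonal (Pi.single j Complex.I : Fin 2 ⊕ Fin 1 → ℂ) := rfl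

/-- The matrix of `t_j` seen in `𝔤` is `i·E_jj`. [cite: BorelWallach2000, VI 4.7] -/
theorem coe_inclusion_tUnit (j : Fin 2 ⊕ Fin 1) :
    ((LieSubalgebra.inclusion G21.compactLie_le_lie (tUnit j) : G21.lie) : Matrix (Fin 2 ⊕ Fin 1) (Fin 2 ⊕ Fin 1) ℂ) =
      Complex.I • Matrix.single j j (1 : ℂ) :=
  diagonal_single_I j

/-- `exp(s·t_j) = diag(e^{s δ_j i})` in `K`, as a matrix. [cite: BorelWallach2000, 0 §2.5] -/
theorem coe_expK_smul_tUnit (j : Fin 2 ⊕ Fin 1) (s : ℝ) :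
    (((G21.expK (s • tUnit j) : G21.maximalCompact) : GL (Fin 2 ⊕ Fin 1) ℂ) : Matrix (Fin 2 ⊕ Fin 1) (Fin 2 ⊕ Fin 1) ℂ) =
      Matrix.diagonal fun a => Complex.exp ((s : ℂ) * (Pi.single j Complex.I : Fin 2 ⊕ Fin 1 → ℂ) a) := by
  rw [RealMatrixGroup.coe_expK, coe_expGL]
  have e : (((s • tUnit j : G21.compactLie)) : Matrix (Fin 2 ⊕ Fin 1) (Fin 2 ⊕ Fin 1) ℂ) =
      Matrix.diagonal fun a => ((s : ℂ) * (Pi.single j Complex.I : Fin 2 ⊕ Fin 1 → ℂ) a) := by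
    rw [show (((s • tUnit j : G21.compactLie)) : Matrix (Fin 2 ⊕ Fin 1) (Fin 2 ⊕ Fin 1) ℂ) =
      s • ((tUnit j : G21.compactLie) : Matrix (Fin 2 ⊕ Fin 1) (Fin 2 ⊕ Fin 1) ℂ) from rfl, coe_tUnit, ← Matrix.diagonal_smul]
    exact congrArg Matrix.diagonal (funext fun a => Complex.real_smul)
  rw [e, Matrix.exp_diagonal]
  refine congrArg Matrix.diagonal (funext fun a => ?_)
  rw [Pi.coe_exp, Complex.exp_eq_exp_ℂ]

/-- **Periodicity**: `exp(2π t_j) = 1` in `K`. [cite: BorelWallach2000, VI 4.7] -/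
theorem expK_two_pi_tUnit (j : Fin 2 ⊕ Fin 1) : G21.expK ((2 * Real.pi) • tUnit j) = 1 := by
  refine Subtype.ext (Units.ext ?_)
  rw [coe_expK_smul_tUnit]
  change _ = (1 : Matrix (Fin 2 ⊕ Fin 1) (Fin 2 ⊕ Fin 1) ℂ)
  rw [← Matrix.diagonal_one]
  refine congrArg Matrix.diagonal (funext fun a => ?_)
  by_cases h : a = j
  · subst h
    rw [Pi.single_eq_same]; push_cast
    rw [show (2 * (Real.pi : ℂ)) * Complex.I = 2 * Real.pi * Complex.I by ring, Complex.exp_two_pi_mul_I]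
  · rw [Pi.single_eq_of_ne h, mul_zero, Complex.exp_zero]

/-- `2π ≠ 0`. [folklore] -/
private theorem two_pi_ne_zero : (2 * Real.pi : ℝ) ≠ 0 := by positivity

section Module

variable {V : Type*} [AddCommGroup V] [Module ℂ V]
  {ρK : Representation ℂ G21.maximalCompact V} (ρ𝔤 : G21.lie →ₗ⁅ℝ⁆ Module.End ℂ V)

/-- **The action of `t_j` is `i·E_jj`** through the complexified action: `ρ𝔤(t_j) = i · ρ_ℂ(E_jj)` (★ `upqLieC_coe`). [cite: Knapp2002, VI §2] -/
theorem apply_tUnit_eq (j : Fin 2 ⊕ Fin 1) :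
    ρ𝔤 (LieSubalgebra.inclusion G21.compactLie_le_lie (tUnit j)) = Complex.I • upqLieC ρ𝔤 (Matrix.single j j 1) := by
  rw [← upqLieC_coe ρ𝔤 (LieSubalgebra.inclusion G21.compactLie_le_lie (tUnit j)), coe_inclusion_tUnit, map_smul]

/-- The diagonal units `E_jj`, `E_kk` act by commuting operators (`E_jj E_kk = E_kk E_jj` as matrices, ★ `upqLieC_comm_of_comm`).
[cite: BorelWallach2000, II §4.1] -/
theorem commute_upqLieC_single_diag (j k : Fin 2 ⊕ Fin 1) :
    Commute (upqLieC ρ𝔤 (Matrix.single j j (1 : ℂ))) (upqLieC ρ𝔤 (Matrix.single k k (1 : ℂ))) := by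
  refine upqLieC_comm_of_comm ρ𝔤 ?_
  by_cases h : j = k
  · subst h; rfl
  · rw [Matrix.single_mul_single_of_ne (c := (1 : ℂ)) j j k h, Matrix.single_mul_single_of_ne (c := (1 : ℂ)) k k j (Ne.symm h)]

/-- The torus units act by commuting operators. [cite: BorelWallach2000, II §4.1] -/
theorem commute_apply_tUnit (j k : Fin 2 ⊕ Fin 1) :
    Commute (ρ𝔤 (LieSubalgebra.inclusion G21.compactLie_le_lie (tUnit j)))
      (ρ𝔤 (LieSubalgebra.inclusion G21.compactLie_le_lie (tUnit k))) := by
  rw [apply_tUnit_eq, apply_tUnit_eq]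
  exact ((commute_upqLieC_single_diag ρ𝔤 j k).smul_left Complex.I).smul_right Complex.I

/-- From a `t_j`-eigenvalue to an `E_jj`-eigenvalue: `ρ𝔤(t_j) v = c v ⇒ E_jj v = (−i c) v`. [cite: Knapp2002, VI §2] -/
theorem upqLieC_single_apply_of_apply_tUnit {j : Fin 2 ⊕ Fin 1} {v : V} {c : ℂ}
    (hv : ρ𝔤 (LieSubalgebra.inclusion G21.compactLie_le_lie (tUnit j)) v = c • v) :
    upqLieC ρ𝔤 (Matrix.single j j 1) v = (-Complex.I * c) • v := by
  rw [apply_tUnit_eq, LinearMap.smul_apply] at hv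
  have h := congrArg (fun x => -Complex.I • x) hv
  simp only [smul_smul] at h
  rw [show -Complex.I * Complex.I = 1 by rw [neg_mul, Complex.I_mul_I, neg_neg], one_smul] at h
  exact h

/-- From an `E_jj`-eigenvalue to a `t_j`-eigenvalue: `E_jj v = c v ⇒ ρ𝔤(t_j) v = (i c) v`. [cite: Knapp2002, VI §2] -/
theorem apply_tUnit_of_upqLieC_single_apply {j : Fin 2 ⊕ Fin 1} {v : V} {c : ℂ} (hv : upqLieC ρ𝔤 (Matrix.single j j 1) v = c • v) :
    ρ𝔤 (LieSubalgebra.inclusion G21.compactLie_le_lie (tUnit j)) v = (Complex.I * c) • v := by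
  rw [apply_tUnit_eq, LinearMap.smul_apply, hv, smul_smul]

/-! ## §2 Torus weight spaces -/

/-- **The torus weight space `V[w]`** (`w : Fin 2 ⊕ Fin 1 → ℤ`): the vectors on which `E_jj` acts by `w j` for every `j` (equivalently `t_j` by `i·w j`;
on `K` the torus `diag(u)` acts by `Π u_j^{w j}`). — a route-posited definition of the engine line (hence untagged). -/
def wtSpace (w : Fin 2 ⊕ Fin 1 → ℤ) : Submodule ℂ V :=
  ⨅ j : Fin 2 ⊕ Fin 1, Module.End.eigenspace (upqLieC ρ𝔤 (Matrix.single j j 1)) (w j : ℂ)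

/-- Membership in a weight space. [cite: KnappVogan1995, Prop. 1.18] -/
theorem mem_wtSpace_iff (w : Fin 2 ⊕ Fin 1 → ℤ) (v : V) :
    v ∈ wtSpace ρ𝔤 w ↔ ∀ j, upqLieC ρ𝔤 (Matrix.single j j 1) v = (w j : ℂ) • v := by
  simp only [wtSpace, Submodule.mem_iInf, Module.End.mem_eigenspace_iff]

/-- **Root operators shift weights**: `E_ab V[w] ⊆ V[w + δ_a − δ_b]` (`[E_jj, E_ab] = δ_ja E_jb − δ_bj E_aj`, ★ `lieHom_single_apply_comm`).
[cite: Kovacevic2021, §3 Thm 1] -/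
theorem upqLieC_single_apply_mem_wtSpace {w : Fin 2 ⊕ Fin 1 → ℤ} {v : V} (hv : v ∈ wtSpace ρ𝔤 w) (a b : Fin 2 ⊕ Fin 1) :
    upqLieC ρ𝔤 (Matrix.single a b 1) v ∈ wtSpace ρ𝔤 (w + Pi.single a 1 - Pi.single b 1) := by
  rw [mem_wtSpace_iff] at hv ⊢
  intro j
  rw [lieHom_single_apply_comm (upqLieC ρ𝔤) j j a b v, hv j, map_smul]
  simp only [Pi.add_apply, Pi.sub_apply, Pi.single_apply, Int.cast_add, Int.cast_sub, Int.cast_ite, Int.cast_one, Int.cast_zero,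
    add_smul, sub_smul, ite_smul, one_smul, zero_smul]
  by_cases hja : j = a
  · subst hja
    by_cases hbj : b = j
    · subst hbj; simp
    · simp [hbj, Ne.symm hbj]
  · by_cases hbj : b = j
    · subst hbj; simp [hja]
    · simp [hja, hbj, Ne.symm hbj]

variable (hV : IsGKModule G21 ρK ρ𝔤)
include hV

/-- **Weights are integral**: an `E_jj`-eigenvalue on a non-zero vector is an integer (`exp(2π t_j) = 1` and ★ `IsGKModule.exp_mul_eq_one_of_eigenvector`).
[cite: KnappVogan1995, Prop. 1.18 (proof)] -/
theorem exists_int_of_eigenvector (j : Fin 2 ⊕ Fin 1) {v : V} {c : ℂ} (hv : upqLieC ρ𝔤 (Matrix.single j j 1) v = c • v) (hv0 : v ≠ 0) :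
    ∃ n : ℤ, c = n := by
  have h1 := hV.exp_mul_eq_one_of_eigenvector (tUnit j) (apply_tUnit_of_upqLieC_single_apply ρ𝔤 hv) hv0 (expK_two_pi_tUnit j)
  obtain ⟨n, hn⟩ := Complex.exp_eq_one_iff.1 h1
  refine ⟨n, ?_⟩
  have h2 : c * (2 * Real.pi * Complex.I) = n * (2 * Real.pi * Complex.I) := by
    rw [← hn]; push_cast; ring
  exact mul_right_cancel₀ (by simp [Real.pi_ne_zero, Complex.I_ne_zero]) h2

/-- **`V = ⨆_w V[w]`**: every vector of a `(𝔤, K)`-module of `U(2,1)` is a finite sum of torus weight vectors (Knapp–Vogan Prop. 1.18 (a) for the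
torus: ★ `GKWeights.maxGenEigenspace_eq_eigenspace` — periodicity kills nilpotents — and Mathlib's simultaneous decomposition of the finite-dimensional
`K`-span of the vector for the three commuting `ρ𝔤(t_j)`). [cite: KnappVogan1995, Prop. 1.18 (a)] -/
theorem iSup_wtSpace_eq_top : ⨆ w : Fin 2 ⊕ Fin 1 → ℤ, wtSpace ρ𝔤 w = ⊤ := by
  rw [eq_top_iff]
  intro v _
  let U : Submodule ℂ V := Submodule.span ℂ (Set.range fun k : G21.maximalCompact => ρK k v)
  haveI : FiniteDimensional ℂ U := hV.kFinite v
  have hUK : ∀ (Z : G21.compactLie) (t : ℝ), ∀ u ∈ U, ρK (G21.expK (t • Z)) u ∈ U :=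
    fun Z t u hu => GKWeights.kSpan_stable v _ hu
  -- the three commuting operators, restricted to `U`
  let f : Fin 2 ⊕ Fin 1 → Module.End ℂ V := fun j => ρ𝔤 (LieSubalgebra.inclusion G21.compactLie_le_lie (tUnit j))
  have hfU : ∀ j, ∀ u ∈ U, f j u ∈ U := fun j u hu => hV.apply_mem_of_expK_stable (tUnit j) (hUK (tUnit j)) hu
  let F : Fin 2 ⊕ Fin 1 → Module.End ℂ U := fun j => (f j).restrict (hfU j)
  have hcomm : Pairwise fun i j => Commute (F i) (F j) := by
    intro i j _
    refine LinearMap.ext fun x => Subtype.ext ?_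
    change f i (f j (x : V)) = f j (f i (x : V))
    rw [← Module.End.mul_apply, (commute_apply_tUnit ρ𝔤 i j).eq, Module.End.mul_apply]
  have htop := Module.End.iSup_iInf_maxGenEigenspace_eq_top_of_iSup_maxGenEigenspace_eq_top_of_commute F hcomm
    (fun i => Module.End.iSup_maxGenEigenspace_eq_top (F i))
  have hvU : (⟨v, GKWeights.mem_kSpan v⟩ : U) ∈ ⨆ χ : Fin 2 ⊕ Fin 1 → ℂ, ⨅ i, Module.End.maxGenEigenspace (F i) (χ i) := by
    rw [htop]; exact Submodule.mem_top
  refine Submodule.iSup_induction (fun χ : Fin 2 ⊕ Fin 1 → ℂ => ⨅ i, Module.End.maxGenEigenspace (F i) (χ i))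
    (motive := fun x : U => (x : V) ∈ ⨆ w : Fin 2 ⊕ Fin 1 → ℤ, wtSpace ρ𝔤 w) hvU ?_ ?_ ?_
  · intro χ x hx
    rw [Submodule.mem_iInf] at hx
    by_cases hx0 : (x : V) = 0
    · rw [hx0]; exact zero_mem _
    -- joint generalised eigenvector ⇒ joint eigenvector ⇒ integral weight vector
    have hj : ∀ j, upqLieC ρ𝔤 (Matrix.single j j 1) (x : V) = (-Complex.I * χ j) • (x : V) := by
      intro j
      have h1 : (x : V) ∈ (f j).maxGenEigenspace (χ j) := by
        have h2 : x ∈ Submodule.comap U.subtype ((f j).genEigenspace (χ j) ⊤) := by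
          rw [← Module.End.genEigenspace_restrict (f j) U ⊤ (χ j) (hfU j)]; exact hx j
        exact h2
      rw [GKWeights.maxGenEigenspace_eq_eigenspace hV (tUnit j) (expK_two_pi_tUnit j) two_pi_ne_zero (χ j),
        Module.End.mem_eigenspace_iff] at h1
      exact upqLieC_single_apply_of_apply_tUnit ρ𝔤 h1
    choose n hn using fun j => exists_int_of_eigenvector ρ𝔤 hV j (hj j) hx0
    refine Submodule.mem_iSup_of_mem n ((mem_wtSpace_iff ρ𝔤 n _).2 fun j => ?_)
    rw [hj j, hn j]
  · exact zero_mem _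
  · intro x y hx hy
    exact add_mem hx hy

omit hV in
/-- **The weight spaces are independent** (joint eigenspaces of a commuting family; Mathlib `independent_iInf_maxGenEigenspace_of_forall_mapsTo`);
no `(𝔤, K)`-axiom is needed for this half. [cite: KnappVogan1995, Prop. 1.18 (a), (1.19)] -/
theorem iSupIndep_wtSpace : iSupIndep fun w : Fin 2 ⊕ Fin 1 → ℤ => wtSpace ρ𝔤 w := by
  let f : Fin 2 ⊕ Fin 1 → Module.End ℂ V := fun j => upqLieC ρ𝔤 (Matrix.single j j 1)
  have hmaps : ∀ i j φ, Set.MapsTo (f i) ((f j).maxGenEigenspace φ) ((f j).maxGenEigenspace φ) :=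
    fun i j φ => Module.End.mapsTo_maxGenEigenspace_of_comm (commute_upqLieC_single_diag ρ𝔤 j i) φ
  have hind := Module.End.independent_iInf_maxGenEigenspace_of_forall_mapsTo f hmaps
  let emb : (Fin 2 ⊕ Fin 1 → ℤ) → (Fin 2 ⊕ Fin 1 → ℂ) := fun w j => (w j : ℂ)
  have hemb : Function.Injective emb := fun w w' h => funext fun j => by
    have h1 : (w j : ℂ) = (w' j : ℂ) := congrFun h j
    exact_mod_cast h1
  refine (hind.comp hemb).mono fun w => ?_
  change wtSpace ρ𝔤 w ≤ ⨅ i, (f i).maxGenEigenspace (emb w i)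
  refine le_iInf fun i => fun v hv => Module.End.eigenspace_le_maxGenEigenspace ?_
  rw [Module.End.mem_eigenspace_iff]
  exact (mem_wtSpace_iff ρ𝔤 w v).1 hv i

/-- **`V = ⨁_w V[w]`**, an internal direct sum over `ℤ³`. [cite: KnappVogan1995, Prop. 1.18 (a), (1.19)] -/
theorem isInternal_wtSpace : DirectSum.IsInternal fun w : Fin 2 ⊕ Fin 1 → ℤ => wtSpace ρ𝔤 w :=
  (DirectSum.isInternal_submodule_iff_iSupIndep_and_iSup_eq_top _).2 ⟨iSupIndep_wtSpace ρ𝔤, iSup_wtSpace_eq_top ρ𝔤 hV⟩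

end Module

end Summit.HodgeConjecture.HodgeConjecture.Cruxes.H413.K2E1bU21Weights

end
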